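import Summits.QuantumFields.YangMills.Theorems.AlphaInputsT3ACDeepFibrePointSizeRows
import Literature.MathematicalPhysics.QuantumFieldTheory.Balaban1983to89.B12GaugeOrbits021
import HarnessLib

/-!
# `AlphaInputsT3ACv3StepLowPrintOrbit` — THE LEVEL-`k` FAMILY LETTER `hloinv` OF THE LOWER ROW AT PRINT'S FAMILY `loPrintAC`, READ IN PRINT'S ORBIT LANGUAGE
# (cell `ym3-torus`, (α)-row #23 `fibre57LowOn`, residue class (E2) at print's constant `c = 1`; seat `ym3-torus-px20` g13, width copy of p1; sequel of
# ✓`AlphaInputsT3ACDeepFibrePointSizeRows`; `--supports stmt-QuantumFields-19936 --as helper`)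

WHAT.  After ✓`AlphaInputsT3AC.PkgCoreRows.fibre57LowOnAC_T3_loPrintAC_of_le_gamma` the lower row of #23 at print's family `loPrintAC 𝔠.lane q.X` ((47) p.267) displays, besides
B0's pins∕`hinv`∕charts∕Gaussian datum and the size window, two level-`k` family letters: `hdom` and the SET-ALGEBRA letter
`hloinv : ∀ u U, gaugeAct u U ∈ loPrintAC 𝔠.lane q.X k ↔ U ∈ loPrintAC 𝔠.lane q.X k` (gauge invariance of print's family).  `loPrintAC k = {(4)-window k} ∩ chiMinAC 1 k`; the
(4)-window is gauge invariant outright (✓`B12GaugeOrbits021.plaqSmall_gaugeAct_iff'`), and `chiMinAC c k = {V | |U_k(V)(∂p) − 1| < c·g_kp(g_k)η² ∀p}` is gauge invariant as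
soon as the minimiser is ORBIT-COVARIANT: «`U_k(V^u)` lies in the gauge orbit of `U_k(V)`» — print's own language for `U_k` («there exists a minimal ORBIT … a unique critical
orbit», [Balaban1985Variational] Thm 1 p.279; «exactly one critical orbit, which is a set of minima … We denote a configuration in this orbit by U_k(V)», [Balaban1987RG1] (0.21)
p.256).  THIS FILE: §1 (any lane, any group, any constant `c`) `chiMinAC_gaugeAct_iff_of_orbit`, `loPrintAC_gaugeAct_iff_of_orbit` (the covariance is needed on the (4)-window
only), `ukAll_zero_orbit` (at `k = 0`, `U_0 = id`, the letter is automatic); §2 (T³ rows record) `hloinv_loPrintAC_of_orbit` = the `hloinv` binder of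
✓`fibre57LowOnAC_T3_loPrintAC_of_le_gamma` VERBATIM from the orbit-covariance letter
`hcov : ∀ u V, PlaqSmall (g_kp(g_k)) V → ∃ w, ukAll q.X.Uk k (gaugeAct u V) = gaugeAct w (ukAll q.X.Uk k V)`, and ★ `fibre57LowOnAC_T3_loPrintAC_of_le_gamma_of_orbit` = that theorem
with `hloinv ↦ hcov`.

HONEST SCOPE.  [folklore] set bookkeeping; def-free.  `hcov` is NOT among the record's minimiser rows r1–r3 (`MinimiserRowsT3`, ✓`AlphaInputsT3ACv2` :105: existence in (8) +
`IsMinOn` over (6), no uniqueness∕covariance clause); for ANY selection of minimisers it follows from the PRINTED uniqueness of the minimal orbit ([Balaban1985Variational] Thm 1, second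
sentence) with the covariance of the constraint (`B16Sect1Backgrounds.iter_gaugeAct`) and the invariance of the Wilson action — a registry row, located here, not typed.  Nothing of
#23's pins, of `hdom`, of (47)∕(57), of the (α) data rows (0∕23), (O‴χₛ), `HistoryTailL` (19936), EX, LOWB∘ or `YM3TorusSU2` is proved (rung R3 = SU(2) YM₃ on T³, a RECORD rung: NOT
d = 4, NOT infinite volume, NOT a mass gap, NOT Clay; the Yang–Mills mass gap is NOT proved).  L-floor: none.
References: T. Bałaban, Commun. Math. Phys. **102** (1985) 255–275 [Balaban1985UV3] ((47) p.267); **102** (1985) 277–309 [Balaban1985Variational] (Thm 1 (8) p.279); **109** (1987)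
249–301 [Balaban1987RG1] ((0.13) p.254, (0.21) p.256).
-/

set_option autoImplicit false

noncomputable section

/-! ## §1 Gauge invariance of print's `χ_k` families from orbit covariance of the minimiser (any lane, any group, any constant) -/

namespace Summit.QuantumFields.YangMills.Theorems.PinnedStep

open MeasureTheory
open Literature.MathematicalPhysics.QuantumFieldTheory.Balaban1983to89
open Literature.MathematicalPhysics.QuantumFieldTheory.Balaban1983to89.GaugeField (gaugeAct)
open Literature.MathematicalPhysics.QuantumFieldTheory.Balaban1985CMP102
open Literature.MathematicalPhysics.QuantumFieldTheory.Balaban1985CMP102.Setting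
open Summit.QuantumFields.Balaban3D.Carriers
open Summit.QuantumFields.Balaban3D.Proofs.Inputs (LaneConsts)
open Summit.QuantumFields.Balaban3D.Proofs.TowerAC
open Summit.QuantumFields.Balaban3D.Proofs.StandardAC
open Summit.QuantumFields.Balaban3D.Proofs.InputsAC

variable {L : ℕ} (𝔎 : LaneConsts L) {S : Scales L} {G : Type} [GaugeGroup G] [MeasurableSpace G] [HaarData G] (X : ExternalInputsAC S G)

/-- **PRINT'S `χ_k` WINDOW IS GAUGE INVARIANT AT A DATUM WHOSE MINIMISER IS ORBIT-COVARIANT** (any constant `c`): if `U_k(V^u) = U_k(V)^w` for some fine gauge transformation `w`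
(`hcov`), then `V^u ∈ chiMinAC 𝔎 X c k ↔ V ∈ chiMinAC 𝔎 X c k` — plaquette smallness is a class function (`|wUw⁻¹(∂p) − 1| = |U(∂p) − 1|`, ✓`plaqSmall_gaugeAct_iff'`).
[cite: Balaban1985UV3, (47) p.267; Balaban1987RG1, (0.13) p.254 + (0.21) p.256] -/
theorem chiMinAC_gaugeAct_iff_of_orbit (c : ℝ) (k : ℕ) (u : GaugeTransf S.P k G) (V : GaugeField S.P k G)
    (hcov : ∃ w : GaugeTransf S.P 0 G, ukAll X.Uk k (gaugeAct u V) = gaugeAct w (ukAll X.Uk k V)) :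
    gaugeAct u V ∈ chiMinAC 𝔎 X c k ↔ V ∈ chiMinAC 𝔎 X c k := by
  obtain ⟨w, hw⟩ := hcov
  rw [mem_chiMinAC_iff, mem_chiMinAC_iff, hw]
  exact B12GaugeOrbits021.plaqSmall_gaugeAct_iff' _ w _

/-- **PRINT'S FAMILY `loPrintAC` IS GAUGE INVARIANT WHEN THE MINIMISER IS ORBIT-COVARIANT ON THE (4)-WINDOW**: the (4)-window conjunct is invariant outright, and on it `hcov` gives the
`chiMinAC 1` conjunct (§1); off the window both memberships fail.  This is the `hloinv` letter of the lower row at print's family, in print's orbit language.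
[cite: Balaban1985UV3, (7) p.257 + (47) p.267; Balaban1985Variational, Thm 1 (8) p.279] -/
theorem loPrintAC_gaugeAct_iff_of_orbit (k : ℕ)
    (hcov : ∀ (u : GaugeTransf S.P k G) (V : GaugeField S.P k G), PlaqSmall (eps1Of S 𝔎.carrier k) V →
      ∃ w : GaugeTransf S.P 0 G, ukAll X.Uk k (gaugeAct u V) = gaugeAct w (ukAll X.Uk k V))
    (u : GaugeTransf S.P k G) (V : GaugeField S.P k G) :
    gaugeAct u V ∈ loPrintAC 𝔎 X k ↔ V ∈ loPrintAC 𝔎 X k := by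
  by_cases hV : PlaqSmall (eps1Of S 𝔎.carrier k) V
  · exact and_congr (B12GaugeOrbits021.plaqSmall_gaugeAct_iff' _ u V) (chiMinAC_gaugeAct_iff_of_orbit 𝔎 X 1 k u V (hcov u V hV))
  · exact ⟨fun h => absurd ((B12GaugeOrbits021.plaqSmall_gaugeAct_iff' _ u V).1 h.1) hV, fun h => absurd h.1 hV⟩

omit [MeasurableSpace G] [HaarData G] in
/-- At `k = 0` the orbit-covariance letter is automatic: `U_0 = id` (ruling R-K0), so `U_0(V^u) = U_0(V)^u`. [cite: Balaban1985UV3, (4) p.256] -/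
theorem ukAll_zero_orbit (Uk : (k : ℕ) → GaugeField S.P (k + 1) G → GaugeField S.P 0 G) (u : GaugeTransf S.P 0 G) (V : GaugeField S.P 0 G) :
    ∃ w : GaugeTransf S.P 0 G, ukAll Uk 0 (gaugeAct u V) = gaugeAct w (ukAll Uk 0 V) :=
  ⟨u, rfl⟩

end Summit.QuantumFields.YangMills.Theorems.PinnedStep

/-! ## §2 At the T³ rows record: `hloinv` of the lower row at print's family from the orbit-covariance letter -/

namespace Summit.QuantumFields.YangMills.Theorems

open MeasureTheory Literature.MathematicalPhysics.QuantumFieldTheory.Balaban1983to89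
open Literature.MathematicalPhysics.QuantumFieldTheory.Balaban1983to89.GaugeField (GaugeInvariant gaugeAct)
open Literature.MathematicalPhysics.QuantumFieldTheory.Balaban1983to89.BlockAveraging (avgFun loopHol Idx)
open Literature.MathematicalPhysics.QuantumFieldTheory.Balaban1983to89.ExpMeanLog (expMeanLogSU)
open Literature.MathematicalPhysics.QuantumFieldTheory.Balaban1983to89.T3ContinuumYM3Torus
open Literature.MathematicalPhysics.QuantumFieldTheory.Balaban1985CMP102 Literature.MathematicalPhysics.QuantumFieldTheory.Balaban1985CMP102.Setting
open Summit.QuantumFields.Balaban3D.Carriers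
open Summit.QuantumFields.Balaban3D.Proofs.Primitives
open Summit.QuantumFields.Balaban3D.Proofs.Thresholds (Q0 Q0_pos)
open Summit.QuantumFields.Balaban3D.Proofs.TowerAC Summit.QuantumFields.Balaban3D.Proofs.StandardAC Summit.QuantumFields.Balaban3D.Proofs.InputsAC
open Summit.QuantumFields.Balaban3D.Proofs.Bound55Masses (chiB)
open Summit.QuantumFields.Balaban3D.Proofs.GaussianNormalization (partZ normalized)
open Summit.QuantumFields.YangMills.Theorems.PinnedStep (Fibre57LowOnAC)
open scoped NNReal ENNReal

namespace AlphaInputsT3AC.PkgCoreRows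

variable {F : T3Family} {𝔠 : AlphaConsts F.L (suGroupModel 2).N} {γ : ℝ} {hγ : 0 < γ} {hγ1 : γ ≤ (min 𝔠.gamma0 1) ^ 2} {K : ℕ}
  (q : AlphaInputsT3AC.PkgCoreRows F 𝔠 γ hγ hγ1 K)

/-- **`hloinv` AT PRINT'S FAMILY FROM ORBIT COVARIANCE OF THE RECORD'S MINIMISER ON THE (4)-WINDOW** — the `hloinv` binder of ✓`fibre57LowOnAC_T3_loPrintAC_of_le_gamma` VERBATIM, from
`hcov : ∀ u V, |V(∂p) − 1| < g_kp(g_k) ∀p → ∃ w, U_k(V^u) = U_k(V)^w` (`U_k = ukAll q.X.Uk k`, print's «configuration in the minimal orbit»).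
[cite: Balaban1985Variational, Thm 1 (8) p.279; Balaban1985UV3, (47) p.267] -/
theorem hloinv_loPrintAC_of_orbit (k : ℕ)
    (hcov : ∀ (u : GaugeTransf (F.P K) k (Matrix.specialUnitaryGroup (Fin 2) ℂ)) (V : GaugeField (F.P K) k (Matrix.specialUnitaryGroup (Fin 2) ℂ)),
      PlaqSmall (eps1Of (T3Scales F γ hγ (hγ1.trans (sq_min_one_le _ 𝔠.gamma0_pos)) K) 𝔠.lane.carrier k) V →
        ∃ w : GaugeTransf (F.P K) 0 (Matrix.specialUnitaryGroup (Fin 2) ℂ), ukAll q.X.Uk k (gaugeAct u V) = gaugeAct w (ukAll q.X.Uk k V)) :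
    ∀ (u : GaugeTransf (F.P K) k (Matrix.specialUnitaryGroup (Fin 2) ℂ)) (U : GaugeField (F.P K) k (Matrix.specialUnitaryGroup (Fin 2) ℂ)),
      gaugeAct u U ∈ PinnedStep.loPrintAC 𝔠.lane q.X k ↔ U ∈ PinnedStep.loPrintAC 𝔠.lane q.X k :=
  fun u U => PinnedStep.loPrintAC_gaugeAct_iff_of_orbit 𝔠.lane q.X k hcov u U

/-- ★ **THE LOWER ROW AT THE T³ RECORD ON PRINT'S FAMILY, `hloinv` READ AS ORBIT COVARIANCE** — ✓`fibre57LowOnAC_T3_loPrintAC_of_le_gamma` (✓`…DeepFibrePointSizeRows` §4) VERBATIM except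
`hloinv ↦ hcov` (orbit covariance of `U_k` on the (4)-window of level `k`).  Displayed after this edition: charts, Gaussian datum, `hinv`, the (55)∕(58) pins of `q.𝔖` at `triv`, `hγs`,
`hcov` (print's «minimal orbit», [7] Thm 1), `hdom` (E2). [cite: Balaban1985UV3, (37) p.265 + (47) p.267 + (55)–(58) pp.269–270 + p.272 L32–33; Balaban1985Variational, Thm 1 (8) p.279] -/
theorem fibre57LowOnAC_T3_loPrintAC_of_le_gamma_of_orbit (hγs : γ ≤ ((((4500 : ℝ) * (F.L : ℝ) ^ 5)⁻¹ / (𝔠.b₀ * Q0 𝔠.p₀)) ^ 2) ^ 2)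
    (k : ℕ) (hk : k + 1 ≤ K)
    (hcov : ∀ (u : GaugeTransf (F.P K) k (Matrix.specialUnitaryGroup (Fin 2) ℂ)) (V : GaugeField (F.P K) k (Matrix.specialUnitaryGroup (Fin 2) ℂ)),
      PlaqSmall (eps1Of (T3Scales F γ hγ (hγ1.trans (sq_min_one_le _ 𝔠.gamma0_pos)) K) 𝔠.lane.carrier k) V →
        ∃ w : GaugeTransf (F.P K) 0 (Matrix.specialUnitaryGroup (Fin 2) ℂ), ukAll q.X.Uk k (gaugeAct u V) = gaugeAct w (ukAll q.X.Uk k V))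
    (Φ : GaugeField (F.P K) (k + 1) (Matrix.specialUnitaryGroup (Fin 2) ℂ) × GaugeField (F.P K) k (Matrix.specialUnitaryGroup (Fin 2) ℂ) →
      GaugeField (F.P K) k (Matrix.specialUnitaryGroup (Fin 2) ℂ))
    (J : GaugeField (F.P K) (k + 1) (Matrix.specialUnitaryGroup (Fin 2) ℂ) × GaugeField (F.P K) k (Matrix.specialUnitaryGroup (Fin 2) ℂ) → ℝ≥0)
    (T : Set (GaugeField (F.P K) (k + 1) (Matrix.specialUnitaryGroup (Fin 2) ℂ) × GaugeField (F.P K) k (Matrix.specialUnitaryGroup (Fin 2) ℂ)))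
    (hΦ : Measurable Φ) (hJ : Measurable J) (hT : MeasurableSet T)
    (hmap : ((((fieldMeasure (F.P K) (k + 1) (Matrix.specialUnitaryGroup (Fin 2) ℂ)).prod
        (fieldMeasure (F.P K) k (Matrix.specialUnitaryGroup (Fin 2) ℂ))).restrict T).withDensity (fun z => (J z : ℝ≥0∞))).map Φ =
      (fieldMeasure (F.P K) k (Matrix.specialUnitaryGroup (Fin 2) ℂ)).restrict
        {U : GaugeField (F.P K) k (Matrix.specialUnitaryGroup (Fin 2) ℂ) |
          ∀ c i, dist1 (loopHol U c i) < ((Fintype.card (Idx (F.P K)) : ℝ))⁻¹ / 10})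
    (hfib : ∀ z ∈ T, avgFun (expMeanLogSU (n := Fin 2)) (Φ z) = z.1) (N lσ dg : ℝ)
    (q_1 : GaugeField (F.P K) (k + 1) (Matrix.specialUnitaryGroup (Fin 2) ℂ) → GaugeField (F.P K) k (Matrix.specialUnitaryGroup (Fin 2) ℂ) → ℝ)
    (hqm : ∀ V, Measurable (q_1 V)) (hZ : ∀ V, 0 < partZ (fieldMeasure (F.P K) k (Matrix.specialUnitaryGroup (Fin 2) ℂ)) (q_1 V))
    (hinv : GaugeInvariant (fun U : GaugeField (F.P K) k (Matrix.specialUnitaryGroup (Fin 2) ℂ) =>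
      Real.exp (-((towerOfAC 𝔠.lane q.X q.𝔖).mainT k (Hist.triv (F.P K) k) U) + (towerOfAC 𝔠.lane q.X q.𝔖).Pint k (Hist.triv (F.P K) k) U)))
    (hdom : ∀ U : GaugeField (F.P K) k (Matrix.specialUnitaryGroup (Fin 2) ℂ),
      chiB 𝔠.lane.carrier.M₁ (rcolOf (T3Scales F γ hγ (hγ1.trans (sq_min_one_le _ 𝔠.gamma0_pos)) K) 𝔠.lane.carrier) (eps1Of (T3Scales F γ hγ (hγ1.trans (sq_min_one_le _ 𝔠.gamma0_pos)) K) 𝔠.lane.carrier) k (Hist.triv (F.P K) (k + 1)) U ≠ 0 → U ∈ PinnedStep.loPrintAC 𝔠.lane q.X k)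
    (hσ : (piecesAC 𝔠.lane q.X q.𝔖 k).logσ₀ = lσ) (hdg : (piecesAC 𝔠.lane q.X q.𝔖 k).dg = dg)
    (hstar : (piecesAC 𝔠.lane q.X q.𝔖 k).starB (Hist.triv (F.P K) (k + 1)) = N)
    (hZU : ∀ V, (piecesAC 𝔠.lane q.X q.𝔖 k).logZU (Hist.triv (F.P K) (k + 1)) V =
      Real.log (partZ (fieldMeasure (F.P K) k (Matrix.specialUnitaryGroup (Fin 2) ℂ)) (q_1 V)))
    (hFl : ∀ V, (piecesAC 𝔠.lane q.X q.𝔖 k).logFl (Hist.triv (F.P K) (k + 1)) V =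
      Real.log (∫ U', (Real.exp (-((lσ + dg * Real.log ((T3Scales F γ hγ (hγ1.trans (sq_min_one_le _ 𝔠.gamma0_pos)) K).gk k)) * N)) * T.indicator (fun z => (J z : ℝ)) (V, U')) *
              chiB 𝔠.lane.carrier.M₁ (rcolOf (T3Scales F γ hγ (hγ1.trans (sq_min_one_le _ 𝔠.gamma0_pos)) K) 𝔠.lane.carrier) (eps1Of (T3Scales F γ hγ (hγ1.trans (sq_min_one_le _ 𝔠.gamma0_pos)) K) 𝔠.lane.carrier) k
                (Hist.triv (F.P K) (k + 1)) (Φ (V, U')) *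
              Real.exp (-((towerOfAC 𝔠.lane q.X q.𝔖).mainT k (Hist.triv (F.P K) k) (Φ (V, U')) -
                    (towerOfAC 𝔠.lane q.X q.𝔖).mainT (k + 1) (Hist.triv (F.P K) (k + 1)) V)
                + ((towerOfAC 𝔠.lane q.X q.𝔖).Pint k (Hist.triv (F.P K) k) (Φ (V, U')) - (piecesAC 𝔠.lane q.X q.𝔖 k).Pold (Hist.triv (F.P K) (k + 1)) V)
                + q_1 V U')
            ∂(normalized (fieldMeasure (F.P K) k (Matrix.specialUnitaryGroup (Fin 2) ℂ)) (q_1 V)))) :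
    Fibre57LowOnAC 𝔠.lane q.X q.𝔖 (PinnedStep.loPrintAC 𝔠.lane q.X) k :=
  q.fibre57LowOnAC_T3_loPrintAC_of_le_gamma hγs k hk Φ J T hΦ hJ hT hmap hfib N lσ dg q_1 hqm hZ hinv (q.hloinv_loPrintAC_of_orbit k hcov) hdom
    hσ hdg hstar hZU hFl

end AlphaInputsT3AC.PkgCoreRows

end Summit.QuantumFields.YangMills.Theorems

end
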